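import Mathlib.Analysis.CStarAlgebra.Matrix
import Mathlib.Logic.Function.DependsOn
import Literature.Analysis.Complex.LogOnePlus
import Literature.MathematicalPhysics.QuantumLattice.WilsonFermionBlockAveraging
import Literature.MathematicalPhysics.QuantumFieldTheory.YangMillsOS
import HarnessLib

/-!
# Bałaban's non-linear gauge-covariant block average of a lattice gauge field

Definition request `defn-balabanBlockAverage` (crux line `femto-sigma-algebra-split` of
`stmt-QuantumFields-9366`; also the intended inhabitant of `BalabanBlockSpecification.blockAvg` and of the
link map of `GaugeCovariantBlockMap`), on top of the tree's torus block geometry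
(`QuantumLattice/WilsonFermionBlockAveraging`: `transport`, `pathEdges`, `pathEnd`, `torusBlockOf`,
`torusBlockCorner`, `torusBlockOffset`, `torusBlockPath`, `blockTransporter`) and of the logarithmic series
`Literature.Analysis.Complex.logOnePlus` (`log (1 + x) = ∑ (-1)^{n+1} xⁿ/n`, `exp (log (1 + x)) = 1 + x`).

## The source

T. Bałaban, *Averaging operations for lattice gauge theories*, CMP **98** (1985) 17–51
[Balaban1985Averaging]. The renormalization transformation is `ρ'(V) = ∫ dU δ(V Ū⁻¹) ρ(U)` (Intro (10)),
built on an averaging `U ↦ Ū` from the bonds of the fine lattice to the bonds `c = ⟨c₋, c₊⟩` of the block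
lattice which must (11) commute with gauge transformations, `Ū^u(c) = u(c₋) Ū(c) u(c₊)⁻¹`, and (14) reduce
at linear order around `U = 1` to the linear averaging `Q` of [Balaban1984Propagators, (1.8)]. His choice
(Intro (15) = Sect. B (42)) is, for a coarse bond `c` and the block `B(c₋)` of `L^d` fine sites,

  `Ū(c) = exp[ L^{-d} ∑_{x ∈ B(c₋)} log( U(Γ_{c,x}) U(c)⁻¹ ) ] · U(c)`,

where `U(c)` is the transporter along the straight coarse bond, `Γ_{c,x} = Γ_{c₋,x} ∪ [x, x(c)] ∪ Γ_{x(c),c₊}`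
is the contour from `c₋` to `c₊` through `x` (taxi path inside the block to `x`, straight segment of `L`
steps, taxi path back inside the neighbouring block; p. 19 after (14)), and `log` is the series (21)
`log X = ∑_{n ≥ 1} (-1)^{n+1} (X - 1)ⁿ / n`, `|X - 1| < 1` (operator norm (19)). Locality ("`Ū_c` depends
only on the bond variables `U_b` for `b ⊂ B(c₋) ∪ B(c₊)`") and covariance (11) are checked on p. 24 after
(43): the matrices `U(Γ_{c,x}) U(c)⁻¹` are conjugated by `u(c₋)`, hence so are their logarithms, the mean
and its exponential. [Balaban1988Convergent, p. 243 (0.1)] uses the same `Ū` ("the averaging operation is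
defined by the formula (0.4), or (0.12) in [I], but we may take any averaging operation satisfying several
general properties").

## What is defined here (tree conventions: blocks labelled by corners `M y`, fine torus of side `M L'`
over the coarse torus of side `L'`, cf. `WilsonFermionBlockAveraging`)

* `straightTransporter M L' U (y, μ) = U(My → My + M e_μ)` (Bałaban's `U(c)`; the tree's
  `GaugeCovariantBlockMap.central` link) and the **dressed transporters**
  `dressedTransporter M L' U y μ x = U(Γ_{My,x}) · U(x → x + M e_μ) · U(Γ_{M(y+e_μ), x + M e_μ})⁻¹`
  (Bałaban's `U(Γ_{c,x})`; both taxi paths are the tree's coordinate-ordered `torusBlockPath M L' x`, the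
  second one started at the corner of the neighbouring block — it ends at `x + M e_μ`,
  `pathEnd_torusBlockCorner_shift`; in the tree's vocabulary `blockTransporter U x · U(x → x + Me_μ) ·
  (blockTransporter U (x + Me_μ))⁻¹`, `dressedTransporter_eq_blockTransporter`, via `torusBlockOf_add_single`,
  `torusBlockPath_add_single`), with gauge covariance, continuity, their values `1` at `U = 1`, the
  identity `dressedTransporter … (My) = straightTransporter …` (the reference is the member `x = My` of
  the family), `transport_replicate` (the straight segment is the tree's `lineHolonomy`) and LOCALITY
  (`straightTransporter_congr`, `dressedTransporter_congr`: only links based in `B(y) ∪ B(y + e_μ)` are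
  read; torus geometry complements `torusBlockCorner_shift`, `torusBlockOf_corner_add`,
  `exists_of_mem_pathEdges`, `torusBlockOf_eq_of_mem_pathEdges_torusBlockPath/_replicate`).
* The abstract **exp/log mean** of a finite family `T : ι → G` relative to a reference `S : G`, in a
  matrix representation `ρ : G →* M_N(ℂ)` (operator norm, `open scoped Matrix.Norms.L2Operator`):
  `IsSmallFamily ρ S T` (`‖ρ(Tᵢ S⁻¹) - 1‖ ≤ 1/2` for all `i` — inside the disc of (21)),
  `balabanMatrixMean ρ S T = exp((#ι)⁻¹ ∑ᵢ log ρ(Tᵢ S⁻¹)) · ρ(S)` (formula (42) verbatim) and the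
  `G`-valued `balabanGroupMean ρ S T`: the `ρ`-preimage of the matrix mean when the family is small and the
  matrix mean lies in `ρ(G)`, and the reference `S` otherwise. Proved: conjugation equivariance
  (`balabanMatrixMean_conj` — no hypothesis on `ρ`; `balabanGroupMean_conj` for unitary faithful `ρ`),
  `balabanGroupMean_one`, `rho_balabanGroupMean` (on the Bałaban branch `ρ(mean) =` (42)), joint Borel
  measurability in `(S, T)` (`measurable_balabanGroupMean`, continuous faithful `ρ` of a compact group).
* **`balabanBlockAverage ρ M L' : GaugeConfig d (M L') G → GaugeConfig d L' G`**, the coarse link `(y, μ)`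
  being the group mean of the `M^d` dressed transporters `x ∈ B(y)` (`TorusBlock M L' y`;
  `torusBlockEquiv : B(y) ≃ (Fin d → Fin M)`, `card_torusBlock : #B(y) = M^d`, so the weight is Bałaban's
  `L^{-d}`) relative to the straight one, and its matrix form `balabanMatrixAverage`. Proved — the four
  properties the request asks for: (i) `measurable_balabanBlockAverage`; (ii) gauge covariance
  `balabanBlockAverage_gaugeTransform : blockAvg (U^g) = (blockAvg U)^{g ∘ torusBlockCorner}` (exactly the
  admissibility field of
  `BalabanBlockSpecification` / `GaugeCovariantBlockMap`); (iii) locality `dependsOn_balabanBlockAverage`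
  (the coarse link `(y, μ)` is a function of the fine links based in `B(y) ∪ B(y + e_μ)`); (iv) the
  linearisation at `U ≡ 1`: along any curve of configurations `U_t` with `U_0 = 1` and
  `d/dt ρ(U_t(b))|₀ = A(b)`, `d/dt balabanMatrixAverage ρ M L' U_t (y,μ)|₀ = linearBlockAverage M L' A (y,μ)
  = (#B(y))⁻¹ ∑_{x ∈ B(y)} A(Γ_{c,x})` (signed sum of `A` along the dressed contour, `pathSum`) — the
  covariant LINEAR block average `Q` of Lie-algebra-valued fields [Balaban1984Propagators, (1.8)] (up to his
  lattice-spacing normalisation of `A`), i.e. condition (14): the reference `S` drops out at first order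
  (`hasDerivAt_balabanMatrixMean`: the derivative of the mean is the arithmetic mean of the derivatives).
  `hasDerivAt_rho_balabanBlockAverage` transfers (iv) to the `G`-valued map along curves that stay on the
  Bałaban branch. `LatticeRep` corollaries: `measurable_balabanBlockAverage_latticeRep`,
  `balabanBlockAverage_gaugeTransform_latticeRep`, `balabanBlockAverage_one`.

## Design choices and faithfulness flags

* TOTALITY. Formula (42) needs `|U(Γ_{c,x})U(c)⁻¹ - 1| < 1` and produces an element of `G` only because
  `log` maps a neighbourhood of `1` in the closed subgroup `ρ(G) ⊆ U(N)` into its Lie algebra (Cartan's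
  theorem; Bałaban p. 20: "The group `G` is obtained by applying the function `e^{iA}` to `A ∈ g`"), which
  Mathlib does not have for an abstract compact `G` with a faithful representation. Bałaban himself uses
  `Ū` only on the small-field domains (44)/(52) ("Formally, it is defined for all configurations, but we
  have good control over it for configurations `U` satisfying the regularity condition (52)", p. 42). The
  request asks for a MEASURABLE TOTAL map; we take (42) whenever the family is small (threshold `1/2` in
  operator norm — any constant `< 1` would do) AND the matrix mean lies in `ρ(G)` (for a compact Lie `G`
  this holds for all fields in a neighbourhood of `U = 1` whose size depends on `ρ(G)` — the logarithm is
  a chart of `ρ(G)` at `1` — so near `U = 1` this branch IS (42); for `ρ(G)` of positive injectivity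
  radius below `1/2`, e.g. a finite `G`, the membership test is a genuine restriction), and the straight
  transporter `U(c)` (the central member `x = My` of the averaged family; decimation,
  `GaugeCovariantBlockMap.central`) otherwise. Both
  branches are covariant with the same law, so (ii) holds for ALL configurations; the branch condition is
  gauge invariant because `ρ` is unitary (the operator norm is conjugation invariant) — this and
  faithfulness (to pull back along `ρ`) are the only properties of `ρ` used. The payload's suggested
  large-field extension (Frobenius-closest element of `ρ(G)` to the linear average) is not a measurable
  single-valued map without a measurable selection theorem; the straight transporter is.
* Blocks by corners and the coordinate-ordered taxi paths of the tree (Bałaban centres blocks and uses the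
  same kind of fixed contours `Γ_{y,x}`); on the torus the conventions differ by a translation.
  One step only (the `k`-th order averages (43) are iterates; re-instantiate `M ↦ M^k`).
* Norm: Bałaban's `|·|` is the operator norm (19), which is what `Matrix.Norms.L2Operator` provides
  (a C⋆-norm: `‖VX‖ = ‖X‖ = ‖XV‖` for unitary `V`).
* NOT here: analyticity and the regularity estimates of Sects. B–E (Propositions 1–7), the averaging of
  gauge transformations (Sect. F), the axial-gauge variants (Sect. C); no claim that the Bałaban branch is
  taken on a neighbourhood of `U = 1` for abstract `G` (it is stated as the hypothesis of
  `hasDerivAt_rho_balabanBlockAverage`).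

## Mathlib status

Mathlib has `NormedSpace.exp` with `exp_units_conj`, `hasFDerivAt_exp_zero`, the C⋆-norm on matrices,
`hasFDerivAt_ringInverse`, `ContinuousOn.measurable_piecewise`; no matrix logarithm (the tree's
`logOnePlus`), no Lie-group structure on closed subgroups of `U(N)`, no lattice gauge theory.
-/

noncomputable section

open scoped Matrix.Norms.L2Operator
open _root_.Filter _root_.Topology _root_.NormedSpace Literature.Analysis.Complex

namespace Literature.MathematicalPhysics.QuantumLattice

open Literature.Probability.LatticeModels QuantumFieldTheory

/-! ### Torus geometry complements -/

section TorusGeometry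

variable {d L : ℕ} {G : Type*}

/-- The straight path of `n` steps in direction `μ` from `c` ends at `c + n e_μ`. [folklore] -/
theorem pathEnd_replicate (c : QuantumFieldTheory.Site d L) (μ : Fin d) (n : ℕ) :
    pathEnd c (List.replicate n μ) = c + Pi.single μ (n : ZMod L) := by
  rw [pathEnd_eq_add, List.map_replicate, List.sum_replicate]
  congr 1
  funext i
  by_cases h : i = μ
  · subst h; simp
  · simp [h]

/-- The base point of every edge of the path from `c` with steps `is` is `c` translated by the step
counts of a proper initial segment of `is`. [folklore] -/
theorem exists_of_mem_pathEdges (c : QuantumFieldTheory.Site d L) (is : List (Fin d))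
    {e : QuantumFieldTheory.Edge d L} (he : e ∈ pathEdges c is) :
    ∃ l : List (Fin d), l.length < is.length ∧ l.Sublist is ∧
      e.1 = c + fun j => ((l.count j : ℕ) : ZMod L) := by
  induction is generalizing c with
  | nil => simp [pathEdges] at he
  | cons i is ih =>
    simp only [pathEdges, List.mem_cons] at he
    rcases he with rfl | he
    · refine ⟨[], by simp, List.nil_sublist _, ?_⟩
      funext j; simp
    · obtain ⟨l, hl, hsub, heq⟩ := ih (c.shift i) he
      refine ⟨i :: l, by simpa using hl, hsub.cons_cons i, ?_⟩
      rw [heq, QuantumFieldTheory.Site.shift, add_assoc]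
      congr 1
      funext j
      simp only [Pi.add_apply, Pi.single_apply, List.count_cons, beq_iff_eq, Nat.cast_add, Nat.cast_ite,
        Nat.cast_one, Nat.cast_zero]
      by_cases hij : j = i
      · subst hij; simp [add_comm]
      · simp [hij, Ne.symm hij]

/-- Two configurations agreeing on the edges of a path have the same transporter along it. [folklore] -/
theorem transport_congr [Monoid G] {U V : GaugeConfig d L G} (c : QuantumFieldTheory.Site d L)
    (is : List (Fin d))
    (h : ∀ e ∈ pathEdges c is, U e = V e) : transport U c is = transport V c is := by
  unfold transport
  rw [List.map_congr_left h]

/-- The transporter of the trivial configuration is trivial. [folklore] -/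
theorem transport_one_config [Monoid G] (c : QuantumFieldTheory.Site d L) (is : List (Fin d)) :
    transport (1 : GaugeConfig d L G) c is = 1 := by
  induction is generalizing c with
  | nil => rfl
  | cons i is ih => rw [transport_cons, ih, Pi.one_apply, one_mul]

/-- The transporter along a fixed path is a continuous function of the configuration (a finite ordered
product of coordinates). [folklore] -/
theorem continuous_transport_config [Monoid G] [TopologicalSpace G] [ContinuousMul G]
    (c : QuantumFieldTheory.Site d L) (is : List (Fin d)) :
    Continuous fun U : GaugeConfig d L G => transport U c is := by
  induction is generalizing c with
  | nil => simp only [transport_nil]; exact continuous_const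
  | cons i is ih => simp only [transport_cons]; exact (continuous_apply _).mul (ih _)

/-- The transporter along the straight path of `n` steps in direction `μ` is the tree's straight-line
holonomy `lineHolonomy U μ n x` (`ConstructiveQFTWave0`). [folklore] -/
theorem transport_replicate [Group G] (U : GaugeConfig d L G) (x : QuantumFieldTheory.Site d L) (μ : Fin d)
    (n : ℕ) : transport U x (List.replicate n μ) = lineHolonomy U μ n x := by
  induction n generalizing x with
  | zero => rfl
  | succ n ih => rw [List.replicate_succ, transport_cons, ih]; rfl

variable (M L' : ℕ)

/-- `M (n mod L') ≡ M n (mod M L')`. [folklore] -/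
theorem natCast_mul_mod_eq_natCast_mul (n : ℕ) :
    ((M * (n % L') : ℕ) : ZMod (M * L')) = ((M * n : ℕ) : ZMod (M * L')) := by
  rw [← Nat.mul_mod_mul_left, ZMod.natCast_mod]

/-- The corner of the neighbouring block: `M (y + e_μ) = M y + M e_μ` on the fine torus. [folklore] -/
theorem torusBlockCorner_shift [NeZero L'] (y : QuantumFieldTheory.Site d L') (μ : Fin d) :
    torusBlockCorner M L' (y.shift μ) = torusBlockCorner M L' y + Pi.single μ ((M : ℕ) : ZMod (M * L')) := by
  funext i
  simp only [torusBlockCorner, QuantumFieldTheory.Site.shift, Pi.add_apply]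
  rw [ZMod.val_add, natCast_mul_mod_eq_natCast_mul, mul_add, Nat.cast_add]
  by_cases h : i = μ
  · subst h
    rw [Pi.single_eq_same, Pi.single_eq_same, ZMod.val_one_eq_one_mod, natCast_mul_mod_eq_natCast_mul,
      mul_one]
  · rw [Pi.single_eq_of_ne h, Pi.single_eq_of_ne h, ZMod.val_zero, mul_zero, Nat.cast_zero, add_zero]

/-- The corner of a block has offset `0`. [folklore] -/
theorem torusBlockOffset_corner [NeZero M] [NeZero L'] (y : TorusSite d L') (i : Fin d) :
    torusBlockOffset M L' (torusBlockCorner M L' y) i = 0 := by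
  have hM : 0 < M := Nat.pos_of_ne_zero (NeZero.ne M)
  have hlt : M * (y i).val < M * L' := Nat.mul_lt_mul_of_pos_left (ZMod.val_lt (y i)) hM
  show ((M * (y i).val : ℕ) : ZMod (M * L')).val % M = 0
  rw [ZMod.val_natCast_of_lt hlt, Nat.mul_mod_right]

/-- The taxi path from a corner to itself is empty. [folklore] -/
theorem torusBlockPath_corner [NeZero M] [NeZero L'] (y : TorusSite d L') :
    torusBlockPath M L' (torusBlockCorner M L' y) = [] := by
  simp [torusBlockPath, torusBlockOffset_corner]

/-- The number of steps in direction `j` of the taxi path to `x` is the offset `x_j mod M`. [folklore] -/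
theorem count_torusBlockPath (x : TorusSite d (M * L')) (j : Fin d) :
    (torusBlockPath M L' x).count j = torusBlockOffset M L' x j := by
  rw [torusBlockPath, List.count_flatten, List.map_map, ← Fin.sum_univ_def]
  simp only [Function.comp_def, List.count_replicate, beq_iff_eq]
  rw [Finset.sum_ite_eq' Finset.univ j, if_pos (Finset.mem_univ j)]

/-- The coordinates of the fine site `M y + w`, `0 ≤ wᵢ < M`, are `M yᵢ + wᵢ < M L'` (no wrap-around).
[folklore] -/
theorem val_torusBlockCorner_add_apply [NeZero M] [NeZero L'] (y : TorusSite d L') {w : Fin d → ℕ}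
    (hw : ∀ i, w i < M) (i : Fin d) :
    ((torusBlockCorner M L' y + fun i => ((w i : ℕ) : ZMod (M * L'))) i).val = M * (y i).val + w i := by
  have hlt : M * (y i).val + w i < M * L' := by
    have hy : (y i).val + 1 ≤ L' := ZMod.val_lt (y i)
    calc M * (y i).val + w i < M * (y i).val + M := Nat.add_lt_add_left (hw i) _
      _ = M * ((y i).val + 1) := by ring
      _ ≤ M * L' := Nat.mul_le_mul_left M hy
  simp only [torusBlockCorner, Pi.add_apply]
  rw [← Nat.cast_add, ZMod.val_natCast_of_lt hlt]

/-- A fine site `M y + w` with `0 ≤ wᵢ < M` lies in the block `y`. [folklore] -/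
theorem torusBlockOf_corner_add [NeZero M] [NeZero L'] (y : TorusSite d L') {w : Fin d → ℕ}
    (hw : ∀ i, w i < M) :
    torusBlockOf M L' (torusBlockCorner M L' y + fun i => ((w i : ℕ) : ZMod (M * L'))) = y := by
  funext i
  have hM : 0 < M := Nat.pos_of_ne_zero (NeZero.ne M)
  simp only [torusBlockOf]
  rw [val_torusBlockCorner_add_apply M L' y hw i, Nat.mul_add_div hM, Nat.div_eq_of_lt (hw i), add_zero,
    ZMod.natCast_zmod_val]

/-- … and its offset is `w`. [folklore] -/
theorem torusBlockOffset_corner_add [NeZero M] [NeZero L'] (y : TorusSite d L') {w : Fin d → ℕ}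
    (hw : ∀ i, w i < M) (i : Fin d) :
    torusBlockOffset M L' (torusBlockCorner M L' y + fun i => ((w i : ℕ) : ZMod (M * L'))) i = w i := by
  simp only [torusBlockOffset]
  rw [val_torusBlockCorner_add_apply M L' y hw i, Nat.mul_add_mod, Nat.mod_eq_of_lt (hw i)]

/-- Translating a fine site by one block in direction `μ` does not change its offsets. [folklore] -/
theorem torusBlockOffset_add_single [NeZero M] [NeZero L'] (x : TorusSite d (M * L')) (μ i : Fin d) :
    torusBlockOffset M L' (x + Pi.single μ ((M : ℕ) : ZMod (M * L'))) i = torusBlockOffset M L' x i := by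
  simp only [torusBlockOffset, Pi.add_apply]
  by_cases h : i = μ
  · subst h
    rw [Pi.single_eq_same, ZMod.val_add, ZMod.val_natCast, Nat.mod_mul_right_mod, Nat.add_mod,
      Nat.mod_mul_right_mod, Nat.mod_self, add_zero, Nat.mod_mod]
  · rw [Pi.single_eq_of_ne h, add_zero]

/-- … nor its taxi path. [folklore] -/
theorem torusBlockPath_add_single [NeZero M] [NeZero L'] (x : TorusSite d (M * L')) (μ : Fin d) :
    torusBlockPath M L' (x + Pi.single μ ((M : ℕ) : ZMod (M * L'))) = torusBlockPath M L' x := by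
  simp only [torusBlockPath, torusBlockOffset_add_single]

/-- Translating a fine site by one block in direction `μ` moves it to the neighbouring block:
`⌊(x + M e_μ)/M⌋ = ⌊x/M⌋ + e_μ`. [folklore] -/
theorem torusBlockOf_add_single [NeZero M] [NeZero L'] (x : TorusSite d (M * L')) (μ : Fin d) :
    torusBlockOf M L' (x + Pi.single μ ((M : ℕ) : ZMod (M * L'))) =
      QuantumFieldTheory.Site.shift (torusBlockOf M L' x) μ := by
  have hM : 0 < M := Nat.pos_of_ne_zero (NeZero.ne M)
  have hxo := torusBlockCorner_torusBlockOf_add_offset (M := M) (L' := L') x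
  conv_lhs => rw [← hxo]
  rw [add_right_comm, ← torusBlockCorner_shift]
  exact torusBlockOf_corner_add M L' _ fun i => Nat.mod_lt _ hM

variable {M L'} in
/-- The taxi path of the block `y ∋ x` started at the corner of `y` ends at `x`. [folklore] -/
theorem pathEnd_torusBlockCorner_torusBlockPath [NeZero M] [NeZero L'] {y : TorusSite d L'}
    {x : TorusSite d (M * L')} (hx : torusBlockOf M L' x = y) :
    pathEnd (torusBlockCorner M L' y) (torusBlockPath M L' x) = x := by
  subst hx; exact pathEnd_torusBlockPath x

variable {M L'} in
/-- The same taxi path started at the corner of the neighbouring block `y + e_μ` ends at `x + M e_μ`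
(so the third factor of the dressed transporter is `U(Γ_{M(y+e_μ), x + M e_μ})`). [folklore] -/
theorem pathEnd_torusBlockCorner_shift [NeZero M] [NeZero L'] {y : QuantumFieldTheory.Site d L'}
    {x : TorusSite d (M * L')} (μ : Fin d) (hx : torusBlockOf M L' x = y) :
    pathEnd (torusBlockCorner M L' (y.shift μ)) (torusBlockPath M L' x) =
      x + Pi.single μ ((M : ℕ) : ZMod (M * L')) := by
  have h := pathEnd_torusBlockPath (M := M) (L' := L') x
  rw [hx, pathEnd_eq_add] at h
  rw [pathEnd_eq_add, torusBlockCorner_shift, add_right_comm, h]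

/-- Every edge of the taxi path `Γ_{My', ·}` of `x` started at the corner of the block `y'` is based in the
block `y'` (its step counts are bounded by the offsets of `x`, which are `< M`). [folklore] -/
theorem torusBlockOf_eq_of_mem_pathEdges_torusBlockPath [NeZero M] [NeZero L'] (y' : TorusSite d L')
    (x : TorusSite d (M * L')) {e : QuantumFieldTheory.Edge d (M * L')}
    (he : e ∈ pathEdges (torusBlockCorner M L' y') (torusBlockPath M L' x)) :
    torusBlockOf M L' e.1 = y' := by
  obtain ⟨l, -, hsub, heq⟩ := exists_of_mem_pathEdges _ _ he
  rw [heq]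
  refine torusBlockOf_corner_add M L' y' fun i => ?_
  calc l.count i ≤ (torusBlockPath M L' x).count i := hsub.count_le i
    _ = torusBlockOffset M L' x i := count_torusBlockPath M L' x i
    _ < M := Nat.mod_lt _ (Nat.pos_of_ne_zero (NeZero.ne M))

/-- Every edge of the straight segment `x → x + M e_μ`, `x ∈ B(y)`, is based in `B(y)` or in `B(y + e_μ)`.
[folklore] -/
theorem torusBlockOf_eq_of_mem_pathEdges_replicate [NeZero M] [NeZero L'] {y : QuantumFieldTheory.Site d L'}
    {x : TorusSite d (M * L')} (hx : torusBlockOf M L' x = y) (μ : Fin d)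
    {e : QuantumFieldTheory.Edge d (M * L')} (he : e ∈ pathEdges x (List.replicate M μ)) :
    torusBlockOf M L' e.1 = y ∨ torusBlockOf M L' e.1 = y.shift μ := by
  obtain ⟨l, hlen, hsub, heq⟩ := exists_of_mem_pathEdges _ _ he
  have hM : 0 < M := Nat.pos_of_ne_zero (NeZero.ne M)
  set k := l.count μ with hk
  have hkM : k < M := lt_of_le_of_lt List.count_le_length (by simpa using hlen)
  have hcount : ∀ j, j ≠ μ → l.count j = 0 := fun j hj => by
    have h := hsub.count_le j
    rw [List.count_replicate] at h
    simpa [show ¬ μ = j from fun h' => hj h'.symm] using h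
  -- `x = My + o` with the offsets `o` of `x`, `oᵢ < M`
  have hxo := torusBlockCorner_torusBlockOf_add_offset (M := M) (L' := L') x
  rw [hx] at hxo
  set o := torusBlockOffset M L' x with ho
  have hoM : ∀ i, o i < M := fun i => Nat.mod_lt _ hM
  by_cases hcase : o μ + k < M
  · left
    let w : Fin d → ℕ := fun i => o i + if i = μ then k else 0
    have hw : ∀ i, w i < M := fun i => by
      by_cases hi : i = μ
      · subst hi; simpa [w] using hcase
      · simpa [w, hi] using hoM i
    have hew : e.1 = torusBlockCorner M L' y + fun i => ((w i : ℕ) : ZMod (M * L')) := by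
      rw [heq, ← hxo, add_assoc]
      congr 1
      funext i
      by_cases hi : i = μ
      · subst hi; simp [w, hk]
      · simp [w, hi, hcount i hi]
    rw [hew]
    exact torusBlockOf_corner_add M L' y hw
  · right
    replace hcase : M ≤ o μ + k := not_lt.1 hcase
    let w : Fin d → ℕ := fun i => if i = μ then o μ + k - M else o i
    have hw : ∀ i, w i < M := fun i => by
      by_cases hi : i = μ
      · subst hi
        simp only [w, if_true]
        have := hoM i
        omega
      · simp only [w, if_neg hi]
        exact hoM i
    have hew : e.1 = torusBlockCorner M L' (y.shift μ) + fun i => ((w i : ℕ) : ZMod (M * L')) := by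
      rw [heq, ← hxo, add_assoc, torusBlockCorner_shift, add_assoc]
      congr 1
      funext i
      simp only [Pi.add_apply]
      by_cases hi : i = μ
      · subst hi
        have hsplit : o i + k = M + (o i + k - M) := by omega
        simp only [w, if_true, Pi.single_eq_same, ← hk]
        rw [← Nat.cast_add, hsplit, Nat.cast_add, Nat.add_sub_cancel_left]
      · simp [w, hi, hcount i hi]
    rw [hew]
    exact torusBlockOf_corner_add M L' _ hw

end TorusGeometry

/-! ### The straight and the dressed transporters of a coarse bond -/

section Transporters

variable {d : ℕ} (M L' : ℕ) {G : Type*}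

/-- **Bałaban's `U(c)`**: the transporter `U(My, μ) U(My + e_μ, μ) ⋯` of `M` steps along the straight coarse
bond `c = (y, μ)` from the corner `My` of `B(y)` to the corner of `B(y + e_μ)` (the tree's
`GaugeCovariantBlockMap.central` link; Bałaban's reference transporter in (15)/(42)).
[cite: Balaban1985Averaging, Intro (15) and Sect. B (42)] -/
def straightTransporter [Monoid G] (U : GaugeConfig d (M * L') G) (e : QuantumFieldTheory.Edge d L') : G :=
  transport U (torusBlockCorner M L' e.1) (List.replicate M e.2)

/-- **The dressed transporter `U(Γ_{c,x})`** of the coarse bond `c = (y, μ)` through the fine site `x` (meant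
for `x ∈ B(y)`): `U(Γ_{My,x}) · U(x → x + M e_μ) · U(Γ_{M(y+e_μ), x+Me_μ})⁻¹`, taxi path inside `B(y)` to `x`,
straight segment of `M` steps, and back along the taxi path of the neighbouring block (p. 19: "`Γ_{c₋,x} ∪
[x, x(c)] ∪ Γ_{x(c),c₊}` is an oriented contour with `c₋` as an initial point and `c₊` as a final point. We
denote it by `Γ_{c,x}`"). [cite: Balaban1985Averaging, Intro (14)–(15)] -/
def dressedTransporter [Group G] (U : GaugeConfig d (M * L') G) (y : QuantumFieldTheory.Site d L')
    (μ : Fin d) (x : TorusSite d (M * L')) : G :=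
  transport U (torusBlockCorner M L' y) (torusBlockPath M L' x) * transport U x (List.replicate M μ) *
    (transport U (torusBlockCorner M L' (y.shift μ)) (torusBlockPath M L' x))⁻¹

/-- **Gauge covariance of `U(c)`**: `U^g(c) = g(My) U(c) g(M(y + e_μ))⁻¹`.
[cite: Balaban1985Averaging, Intro (11)] -/
theorem straightTransporter_gaugeTransform [Group G] [NeZero L'] (g : TorusSite d (M * L') → G)
    (U : GaugeConfig d (M * L') G) (e : QuantumFieldTheory.Edge d L') :
    straightTransporter M L' (gaugeTransform g U) e =
      g (torusBlockCorner M L' e.1) * straightTransporter M L' U e *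
        (g (torusBlockCorner M L' (e.1.shift e.2)))⁻¹ := by
  rw [straightTransporter, straightTransporter, transport_gaugeTransform, pathEnd_replicate,
    torusBlockCorner_shift]

/-- **Gauge covariance of the dressed transporters**: for `x ∈ B(y)`,
`U^g(Γ_{c,x}) = g(My) U(Γ_{c,x}) g(M(y + e_μ))⁻¹` (telescoping; p. 24 after (43)).
[cite: Balaban1985Averaging, Sect. B, after (43)] -/
theorem dressedTransporter_gaugeTransform [Group G] [NeZero M] [NeZero L'] (g : TorusSite d (M * L') → G)
    (U : GaugeConfig d (M * L') G) {y : QuantumFieldTheory.Site d L'} (μ : Fin d)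
    {x : TorusSite d (M * L')} (hx : torusBlockOf M L' x = y) :
    dressedTransporter M L' (gaugeTransform g U) y μ x =
      g (torusBlockCorner M L' y) * dressedTransporter M L' U y μ x *
        (g (torusBlockCorner M L' (y.shift μ)))⁻¹ := by
  simp only [dressedTransporter, transport_gaugeTransform, pathEnd_replicate,
    pathEnd_torusBlockCorner_torusBlockPath hx, pathEnd_torusBlockCorner_shift μ hx]
  group

/-- The dressed transporter through the corner `x = My` is the straight transporter `U(c)` itself (both
taxi paths are empty): the reference is a member of the averaged family. [folklore] -/
theorem dressedTransporter_corner [Group G] [NeZero M] [NeZero L'] (U : GaugeConfig d (M * L') G)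
    (y : QuantumFieldTheory.Site d L') (μ : Fin d) :
    dressedTransporter M L' U y μ (torusBlockCorner M L' y) = straightTransporter M L' U (y, μ) := by
  simp [dressedTransporter, straightTransporter, torusBlockPath_corner]

/-- The dressed transporter in the tree's vocabulary: for `x ∈ B(y)`,
`U(Γ_{c,x}) = blockTransporter U x · U(x → x + M e_μ) · (blockTransporter U (x + M e_μ))⁻¹` (the request's
formula; `x + M e_μ ∈ B(y + e_μ)` has the same taxi path as `x`). [folklore] -/
theorem dressedTransporter_eq_blockTransporter [Group G] [NeZero M] [NeZero L']
    (U : GaugeConfig d (M * L') G) {y : QuantumFieldTheory.Site d L'} (μ : Fin d)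
    {x : TorusSite d (M * L')} (hx : torusBlockOf M L' x = y) :
    dressedTransporter M L' U y μ x = blockTransporter M L' U x * transport U x (List.replicate M μ) *
      (blockTransporter M L' U (x + Pi.single μ ((M : ℕ) : ZMod (M * L'))))⁻¹ := by
  subst hx
  simp only [dressedTransporter, blockTransporter, torusBlockOf_add_single, torusBlockPath_add_single]

/-- `U(c) = 1` for the trivial configuration. [folklore] -/
@[simp] theorem straightTransporter_one [Monoid G] (e : QuantumFieldTheory.Edge d L') :
    straightTransporter M L' (1 : GaugeConfig d (M * L') G) e = 1 :=
  transport_one_config _ _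

/-- `U(Γ_{c,x}) = 1` for the trivial configuration. [folklore] -/
@[simp] theorem dressedTransporter_one [Group G] (y : QuantumFieldTheory.Site d L') (μ : Fin d)
    (x : TorusSite d (M * L')) :
    dressedTransporter M L' (1 : GaugeConfig d (M * L') G) y μ x = 1 := by
  simp [dressedTransporter, transport_one_config]

/-- `U ↦ U(c)` is continuous. [folklore] -/
theorem continuous_straightTransporter [Monoid G] [TopologicalSpace G] [ContinuousMul G]
    (e : QuantumFieldTheory.Edge d L') :
    Continuous fun U : GaugeConfig d (M * L') G => straightTransporter M L' U e :=
  continuous_transport_config _ _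

/-- `U ↦ U(Γ_{c,x})` is continuous. [folklore] -/
theorem continuous_dressedTransporter [Group G] [TopologicalSpace G] [IsTopologicalGroup G]
    (y : QuantumFieldTheory.Site d L') (μ : Fin d) (x : TorusSite d (M * L')) :
    Continuous fun U : GaugeConfig d (M * L') G => dressedTransporter M L' U y μ x :=
  ((continuous_transport_config _ _).mul (continuous_transport_config _ _)).mul
    (continuous_transport_config _ _).inv

/-- **Locality of `U(c)`**: it reads only links based in `B(y) ∪ B(y + e_μ)` (in fact only in `B(y)`).
[cite: Balaban1985Averaging, Sect. B, after (43)] -/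
theorem straightTransporter_congr [Monoid G] [NeZero M] [NeZero L'] {U V : GaugeConfig d (M * L') G}
    (e : QuantumFieldTheory.Edge d L')
    (h : ∀ e' : QuantumFieldTheory.Edge d (M * L'),
      torusBlockOf M L' e'.1 = e.1 ∨ torusBlockOf M L' e'.1 = e.1.shift e.2 → U e' = V e') :
    straightTransporter M L' U e = straightTransporter M L' V e :=
  transport_congr _ _ fun e' he' =>
    h e' (torusBlockOf_eq_of_mem_pathEdges_replicate M L' (torusBlockOf_torusBlockCorner e.1) e.2 he')

/-- **Locality of the dressed transporters** ("`Ū_c` depends only on the bond variables `U_b` for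
`b ⊂ B(c₋) ∪ B(c₊)`", p. 24): for `x ∈ B(y)`, `U(Γ_{c,x})` reads only links based in `B(y) ∪ B(y + e_μ)`.
[cite: Balaban1985Averaging, Sect. B, after (43)] -/
theorem dressedTransporter_congr [Group G] [NeZero M] [NeZero L'] {U V : GaugeConfig d (M * L') G}
    {y : QuantumFieldTheory.Site d L'} (μ : Fin d) {x : TorusSite d (M * L')} (hx : torusBlockOf M L' x = y)
    (h : ∀ e' : QuantumFieldTheory.Edge d (M * L'),
      torusBlockOf M L' e'.1 = y ∨ torusBlockOf M L' e'.1 = y.shift μ → U e' = V e') :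
    dressedTransporter M L' U y μ x = dressedTransporter M L' V y μ x := by
  unfold dressedTransporter
  rw [transport_congr _ _ fun e' he' =>
      h e' (Or.inl (torusBlockOf_eq_of_mem_pathEdges_torusBlockPath M L' y x he')),
    transport_congr _ _ fun e' he' => h e' (torusBlockOf_eq_of_mem_pathEdges_replicate M L' hx μ he'),
    transport_congr (U := U) _ _ fun e' he' =>
      h e' (Or.inr (torusBlockOf_eq_of_mem_pathEdges_torusBlockPath M L' (y.shift μ) x he'))]

end Transporters

/-! ### The exp/log mean of a finite family relative to a reference, in a matrix representation -/

section Mean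

variable {G : Type*} [Group G] {N : ℕ} (ρ : G →* Matrix (Fin N) (Fin N) ℂ) {ι : Type*} [Fintype ι]

/-- Conjugation commutes with the logarithmic series: `log(1 + v x w) = v log(1 + x) w` for `v w = w v = 1`
(term by term; Bałaban p. 24: "their logarithms are unitarily equivalent with the same unitary operator").
[cite: Balaban1985Averaging, Sect. B, after (43)] -/
theorem logOnePlus_conj {𝔄 : Type*} [NormedRing 𝔄] [NormedAlgebra ℂ 𝔄] [CompleteSpace 𝔄] {v w : 𝔄}
    (hvw : v * w = 1) (hwv : w * v = 1) (x : 𝔄) : logOnePlus (v * x * w) = v * logOnePlus x * w := by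
  let u : 𝔄ˣ := ⟨v, w, hvw, hwv⟩
  let Lc : 𝔄 →L[ℂ] 𝔄 := ContinuousLinearMap.mulLeftRight ℂ 𝔄 v w
  let Lc' : 𝔄 →L[ℂ] 𝔄 := ContinuousLinearMap.mulLeftRight ℂ 𝔄 w v
  have hL : ∀ y, Lc y = v * y * w := fun y => rfl
  have hL' : ∀ y, Lc' (Lc y) = y := fun y => by
    show w * (v * y * w) * v = y
    rw [← mul_assoc, ← mul_assoc, hwv, one_mul, mul_assoc, hwv, mul_one]
  have hterm : (fun n => logSeriesCoeff n • (v * x * w) ^ n) = fun n => Lc (logSeriesCoeff n • x ^ n) := by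
    funext n
    rw [show (v * x * w) ^ n = v * x ^ n * w from u.conj_pow x n, map_smul, hL]
  unfold logOnePlus
  rw [hterm]
  by_cases hs : Summable fun n => logSeriesCoeff n • x ^ n
  · rw [← ContinuousLinearMap.map_tsum Lc hs, hL]
  · have hs' : ¬ Summable fun n => Lc (logSeriesCoeff n • x ^ n) := fun h =>
      hs (by simpa [Function.comp_def, hL'] using h.map Lc' Lc'.continuous)
    rw [tsum_eq_zero_of_not_summable hs, tsum_eq_zero_of_not_summable hs', mul_zero, zero_mul]

/-- Conjugation commutes with the exponential: `exp(v x w) = v exp(x) w` for `v w = w v = 1` (Mathlib's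
`exp_units_conj`). [folklore] -/
theorem exp_conj_eq_of_mul_eq_one {𝔄 : Type*} [NormedRing 𝔄] [NormedAlgebra ℂ 𝔄] [CompleteSpace 𝔄]
    {v w : 𝔄} (hvw : v * w = 1) (hwv : w * v = 1) (x : 𝔄) :
    NormedSpace.exp (v * x * w) = v * NormedSpace.exp x * w := by
  letI : NormedAlgebra ℚ 𝔄 := NormedAlgebra.restrictScalars ℚ ℂ 𝔄
  exact exp_units_conj ⟨v, w, hvw, hwv⟩ x

/-- **Small family**: every member `Tᵢ` is close to the reference `S` in the representation,
`‖ρ(Tᵢ S⁻¹) - 1‖ ≤ 1/2` (operator norm) — inside the disc `|X - 1| < 1` of Bałaban's logarithm (21); the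
constant `1/2` is a convention of this file. [cite: Balaban1985Averaging, Sect. A (21)] -/
def IsSmallFamily (S : G) (T : ι → G) : Prop :=
  ∀ i, ‖ρ (T i * S⁻¹) - 1‖ ≤ 1 / 2

/-- **Bałaban's matrix mean (42)** of the family `T` relative to `S`:
`exp( (#ι)⁻¹ ∑ᵢ log ρ(Tᵢ S⁻¹) ) · ρ(S)`, with `log X = logOnePlus (X - 1)`.
[cite: Balaban1985Averaging, Intro (15) and Sect. B (42)] -/
def balabanMatrixMean (S : G) (T : ι → G) : Matrix (Fin N) (Fin N) ℂ :=
  NormedSpace.exp ((Fintype.card ι : ℂ)⁻¹ • ∑ i, logOnePlus (ρ (T i * S⁻¹) - 1)) * ρ S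

open Classical in
/-- **The `G`-valued mean**: the `ρ`-preimage of `balabanMatrixMean ρ S T` when the family is small and the
matrix mean lies in `ρ(G)` (Bałaban's branch — for a closed subgroup `ρ(G) ⊆ U(N)` the second condition
follows from the first once the family is close enough to the reference, closer than a constant depending
on `ρ(G)`), and the reference `S` otherwise (measurable total extension, see the module docstring).
[cite: Balaban1985Averaging, Intro (15) and Sect. B (42)] -/
def balabanGroupMean (S : G) (T : ι → G) : G :=
  if IsSmallFamily ρ S T ∧ balabanMatrixMean ρ S T ∈ Set.range ρ then
    Function.invFun ρ (balabanMatrixMean ρ S T) else S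

/-- On Bałaban's branch the `G`-valued mean represents the matrix mean (42). [folklore] -/
theorem rho_balabanGroupMean {S : G} {T : ι → G}
    (h : IsSmallFamily ρ S T ∧ balabanMatrixMean ρ S T ∈ Set.range ρ) :
    ρ (balabanGroupMean ρ S T) = balabanMatrixMean ρ S T := by
  rw [balabanGroupMean, if_pos h]
  exact Function.invFun_eq h.2

/-- Off Bałaban's branch the `G`-valued mean is the reference. [folklore] -/
theorem balabanGroupMean_of_not {S : G} {T : ι → G}
    (h : ¬ (IsSmallFamily ρ S T ∧ balabanMatrixMean ρ S T ∈ Set.range ρ)) :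
    balabanGroupMean ρ S T = S := by
  rw [balabanGroupMean, if_neg h]

/-- The matrix mean of the trivial family is `1`. [folklore] -/
@[simp] theorem balabanMatrixMean_one : balabanMatrixMean ρ (1 : G) (fun _ : ι => (1 : G)) = 1 := by
  simp [balabanMatrixMean]

omit [Fintype ι] in
/-- The trivial family is small. [folklore] -/
theorem isSmallFamily_one : IsSmallFamily ρ (1 : G) (fun _ : ι => (1 : G)) := fun i => by
  norm_num [map_one]

/-- The `G`-valued mean of the trivial family is `1` (faithful `ρ`). [folklore] -/
theorem balabanGroupMean_one (hinj : Function.Injective ρ) :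
    balabanGroupMean ρ (1 : G) (fun _ : ι => (1 : G)) = 1 := by
  have h : IsSmallFamily ρ (1 : G) (fun _ : ι => (1 : G)) ∧
      balabanMatrixMean ρ (1 : G) (fun _ : ι => (1 : G)) ∈ Set.range ρ :=
    ⟨isSmallFamily_one ρ, ⟨1, by simp⟩⟩
  rw [balabanGroupMean, if_pos h, balabanMatrixMean_one, ← map_one ρ]
  exact Function.leftInverse_invFun hinj 1

/-! #### Conjugation equivariance -/

omit [Fintype ι] in
/-- The relative fluctuations of the conjugated family `(a Tᵢ b⁻¹, a S b⁻¹)` are the `ρ(a)`-conjugates of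
those of `(T, S)`. [folklore] -/
theorem rho_conj_mul_inv (a b S : G) (T : ι → G) (i : ι) :
    ρ (a * T i * b⁻¹ * (a * S * b⁻¹)⁻¹) - 1 = ρ a * (ρ (T i * S⁻¹) - 1) * ρ a⁻¹ := by
  rw [show a * T i * b⁻¹ * (a * S * b⁻¹)⁻¹ = a * (T i * S⁻¹) * a⁻¹ by group, map_mul, map_mul, mul_sub,
    sub_mul, mul_one, ← map_mul ρ a a⁻¹, mul_inv_cancel, map_one]

omit [Fintype ι] in
/-- `ρ(a) ρ(a⁻¹) = 1`. [folklore] -/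
theorem map_mul_map_inv (a : G) : ρ a * ρ a⁻¹ = 1 := by
  rw [← map_mul, mul_inv_cancel, map_one]

omit [Fintype ι] in
/-- `ρ(a⁻¹) ρ(a) = 1`. [folklore] -/
theorem map_inv_mul_map (a : G) : ρ a⁻¹ * ρ a = 1 := by
  rw [← map_mul, inv_mul_cancel, map_one]

/-- **Equivariance of the matrix mean** (no hypothesis on `ρ`): the mean of `(a Tᵢ b⁻¹)` relative to
`a S b⁻¹` is `ρ(a) · mean · ρ(b⁻¹)` — logarithms, their average and its exponential are conjugated by
`ρ(a)` (p. 24). [cite: Balaban1985Averaging, Sect. B, after (43)] -/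
theorem balabanMatrixMean_conj (a b S : G) (T : ι → G) :
    balabanMatrixMean ρ (a * S * b⁻¹) (fun i => a * T i * b⁻¹) = ρ a * balabanMatrixMean ρ S T * ρ b⁻¹ := by
  have hvw := map_mul_map_inv ρ a
  have hwv := map_inv_mul_map ρ a
  have hlog : ∀ i, logOnePlus (ρ (a * T i * b⁻¹ * (a * S * b⁻¹)⁻¹) - 1) =
      ρ a * logOnePlus (ρ (T i * S⁻¹) - 1) * ρ a⁻¹ := fun i => by
    rw [rho_conj_mul_inv, logOnePlus_conj hvw hwv]
  have hsum : (Fintype.card ι : ℂ)⁻¹ • ∑ i, logOnePlus (ρ (a * T i * b⁻¹ * (a * S * b⁻¹)⁻¹) - 1) =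
      ρ a * ((Fintype.card ι : ℂ)⁻¹ • ∑ i, logOnePlus (ρ (T i * S⁻¹) - 1)) * ρ a⁻¹ := by
    simp_rw [hlog]
    rw [← Finset.sum_mul, ← Finset.mul_sum, mul_smul_comm, smul_mul_assoc]
  rw [balabanMatrixMean, balabanMatrixMean, hsum, exp_conj_eq_of_mul_eq_one hvw hwv, map_mul, map_mul]
  simp only [mul_assoc]
  rw [← mul_assoc (ρ a⁻¹) (ρ a), hwv, one_mul]

omit [Fintype ι] in
/-- Smallness is invariant under conjugation when `ρ` is unitary (the operator norm is unitarily
invariant). [cite: Balaban1985Averaging, Sect. A (19)–(20)] -/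
theorem isSmallFamily_conj_iff (hρu : ∀ g, ρ g ∈ Matrix.unitaryGroup (Fin N) ℂ) (a b S : G) (T : ι → G) :
    IsSmallFamily ρ (a * S * b⁻¹) (fun i => a * T i * b⁻¹) ↔ IsSmallFamily ρ S T := by
  have hnorm : ∀ i, ‖ρ (a * T i * b⁻¹ * (a * S * b⁻¹)⁻¹) - 1‖ = ‖ρ (T i * S⁻¹) - 1‖ := fun i => by
    rw [rho_conj_mul_inv, CStarRing.norm_mul_mem_unitary _ (hρu a⁻¹),
      CStarRing.norm_mem_unitary_mul _ (hρu a)]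
  simp only [IsSmallFamily, hnorm]

/-- **Equivariance of the `G`-valued mean** (unitary faithful `ρ`): the mean of `(a Tᵢ b⁻¹)` relative to
`a S b⁻¹` is `a · mean · b⁻¹` — on both branches. [cite: Balaban1985Averaging, Intro (11)] -/
theorem balabanGroupMean_conj (hρu : ∀ g, ρ g ∈ Matrix.unitaryGroup (Fin N) ℂ)
    (hinj : Function.Injective ρ) (a b S : G) (T : ι → G) :
    balabanGroupMean ρ (a * S * b⁻¹) (fun i => a * T i * b⁻¹) = a * balabanGroupMean ρ S T * b⁻¹ := by
  have hmean := balabanMatrixMean_conj ρ a b S T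
  have hsmall := isSmallFamily_conj_iff ρ hρu a b S T
  by_cases h : IsSmallFamily ρ S T ∧ balabanMatrixMean ρ S T ∈ Set.range ρ
  · obtain ⟨g, hg⟩ := h.2
    have h' : IsSmallFamily ρ (a * S * b⁻¹) (fun i => a * T i * b⁻¹) ∧
        balabanMatrixMean ρ (a * S * b⁻¹) (fun i => a * T i * b⁻¹) ∈ Set.range ρ :=
      ⟨hsmall.2 h.1, ⟨a * g * b⁻¹, by rw [hmean, ← hg, map_mul, map_mul]⟩⟩
    rw [balabanGroupMean, if_pos h', balabanGroupMean, if_pos h, hmean, ← hg, ← map_mul, ← map_mul,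
      Function.leftInverse_invFun hinj, Function.leftInverse_invFun hinj]
  · have h' : ¬ (IsSmallFamily ρ (a * S * b⁻¹) (fun i => a * T i * b⁻¹) ∧
        balabanMatrixMean ρ (a * S * b⁻¹) (fun i => a * T i * b⁻¹) ∈ Set.range ρ) := by
      rintro ⟨h1, g', hg'⟩
      refine h ⟨hsmall.1 h1, ⟨a⁻¹ * g' * b, ?_⟩⟩
      rw [map_mul, map_mul, hg', hmean]
      simp only [← mul_assoc, ← map_mul, inv_mul_cancel, map_one, one_mul]
      rw [mul_assoc, ← map_mul, inv_mul_cancel, map_one, mul_one]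
    rw [balabanGroupMean, if_neg h', balabanGroupMean, if_neg h]

/-! #### Measurability -/

/-- The matrix mean is continuous on the small families (the logarithmic series converges uniformly on
`|X - 1| ≤ 1/2`). [cite: Balaban1985Averaging, Sect. A (21)] -/
theorem continuousOn_balabanMatrixMean [TopologicalSpace G] [IsTopologicalGroup G] (hρc : Continuous ρ) :
    ContinuousOn (fun p : G × (ι → G) => balabanMatrixMean ρ p.1 p.2) {p | IsSmallFamily ρ p.1 p.2} := by
  letI : NormedAlgebra ℚ (Matrix (Fin N) (Fin N) ℂ) := NormedAlgebra.restrictScalars ℚ ℂ _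
  have hW : ∀ i, Continuous fun p : G × (ι → G) => ρ (p.2 i * p.1⁻¹) - 1 := fun i =>
    (hρc.comp (by fun_prop)).sub continuous_const
  have hlog : ∀ i, ContinuousOn (fun p : G × (ι → G) => logOnePlus (ρ (p.2 i * p.1⁻¹) - 1))
      {p | IsSmallFamily ρ p.1 p.2} := fun i =>
    continuousOn_logOnePlus.comp (hW i).continuousOn fun p hp =>
      Metric.mem_ball.2 (by simpa using (hp i).trans_lt (by norm_num : (1 : ℝ) / 2 < 1))
  have hsum : ContinuousOn
      (fun p : G × (ι → G) => (Fintype.card ι : ℂ)⁻¹ • ∑ i, logOnePlus (ρ (p.2 i * p.1⁻¹) - 1))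
      {p | IsSmallFamily ρ p.1 p.2} :=
    (continuousOn_finsetSum Finset.univ fun i _ => hlog i).fun_const_smul _
  have hexp : ContinuousOn (fun p : G × (ι → G) =>
      NormedSpace.exp ((Fintype.card ι : ℂ)⁻¹ • ∑ i, logOnePlus (ρ (p.2 i * p.1⁻¹) - 1)))
      {p | IsSmallFamily ρ p.1 p.2} :=
    exp_continuous.comp_continuousOn hsum
  exact hexp.mul (hρc.comp continuous_fst).continuousOn

omit [Fintype ι] in
/-- The set of small families is closed. [folklore] -/
theorem isClosed_setOf_isSmallFamily [TopologicalSpace G] [IsTopologicalGroup G] (hρc : Continuous ρ) :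
    IsClosed {p : G × (ι → G) | IsSmallFamily ρ p.1 p.2} := by
  have hW : ∀ i, Continuous fun p : G × (ι → G) => ρ (p.2 i * p.1⁻¹) - 1 := fun i =>
    (hρc.comp (by fun_prop)).sub continuous_const
  simp only [IsSmallFamily, Set.setOf_forall]
  exact isClosed_iInter fun i => isClosed_le (hW i).norm continuous_const

/-- The inverse of a faithful continuous representation of a compact group is continuous on its
(closed) range. [folklore] -/
theorem continuousOn_invFun_range [TopologicalSpace G] [CompactSpace G] (hρc : Continuous ρ)
    (hinj : Function.Injective ρ) : ContinuousOn (Function.invFun ρ) (Set.range ρ) := by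
  rw [continuousOn_iff_isClosed]
  intro C hC
  refine ⟨ρ '' C, (hρc.isClosedEmbedding hinj).isClosedMap C hC, ?_⟩
  ext m
  constructor
  · rintro ⟨hm, g, rfl⟩
    refine ⟨⟨Function.invFun ρ (ρ g), hm, ?_⟩, g, rfl⟩
    rw [Function.leftInverse_invFun hinj g]
  · rintro ⟨⟨c, hc, rfl⟩, -⟩
    refine ⟨?_, c, rfl⟩
    show Function.invFun ρ (ρ c) ∈ C
    rwa [Function.leftInverse_invFun hinj c]

/-- **Measurability of the `G`-valued mean**, jointly in the reference and the family, for a faithful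
continuous `ρ` of a compact `G`: the Bałaban branch `{small ∧ mean ∈ ρ(G)}` is closed, on it the mean is
`ρ⁻¹ ∘ (42)` (continuous), off it the reference (continuous). [folklore] -/
theorem measurable_balabanGroupMean [TopologicalSpace G] [IsTopologicalGroup G] [CompactSpace G]
    [MeasurableSpace G] [BorelSpace G] (hρc : Continuous ρ) (hinj : Function.Injective ρ) :
    Measurable fun p : G × (ι → G) => balabanGroupMean ρ p.1 p.2 := by
  classical
  haveI : SecondCountableTopology G :=
    (hρc.isClosedEmbedding hinj).isEmbedding.secondCountableTopology
  set s : Set (G × (ι → G)) :=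
    {p | IsSmallFamily ρ p.1 p.2 ∧ balabanMatrixMean ρ p.1 p.2 ∈ Set.range ρ} with hs
  have hsub : s ⊆ {p | IsSmallFamily ρ p.1 p.2} := fun p hp => hp.1
  have hclosed : IsClosed s :=
    (continuousOn_balabanMatrixMean ρ hρc).preimage_isClosed_of_isClosed
      (isClosed_setOf_isSmallFamily ρ hρc) (hρc.isClosedEmbedding hinj).isClosed_range
  have hf : ContinuousOn (fun p : G × (ι → G) => Function.invFun ρ (balabanMatrixMean ρ p.1 p.2)) s :=
    (continuousOn_invFun_range ρ hρc hinj).comp ((continuousOn_balabanMatrixMean ρ hρc).mono hsub)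
      fun p hp => hp.2
  have heq : (fun p : G × (ι → G) => balabanGroupMean ρ p.1 p.2) = s.piecewise
      (fun p => Function.invFun ρ (balabanMatrixMean ρ p.1 p.2)) Prod.fst := by
    funext p
    by_cases hp : p ∈ s
    · rw [Set.piecewise_eq_of_mem _ _ _ hp, balabanGroupMean]
      exact if_pos hp
    · rw [Set.piecewise_eq_of_notMem _ _ _ hp, balabanGroupMean]
      exact if_neg hp
  rw [heq]
  exact hf.measurable_piecewise continuous_fst.continuousOn hclosed.measurableSet

/-! #### Linearisation: the derivative of the mean is the mean of the derivatives -/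

/-- The logarithmic series has derivative `id` at `0` (`log(1 + x) = x + O(x²)`). [folklore] -/
theorem hasFDerivAt_logOnePlus_zero {𝔄 : Type*} [NormedRing 𝔄] [NormedAlgebra ℂ 𝔄] [CompleteSpace 𝔄] :
    HasFDerivAt (logOnePlus : 𝔄 → 𝔄) (ContinuousLinearMap.id ℂ 𝔄) 0 := by
  have h := (hasFPowerSeriesOnBall_logOnePlus (𝔄 := 𝔄)).hasFPowerSeriesAt.hasFDerivAt
  refine h.congr_fderiv (ContinuousLinearMap.ext fun v => ?_)
  rw [ContinuousLinearMap.id_apply, continuousMultilinearCurryFin1_apply,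
    show (Fin.snoc (0 : Fin 0 → 𝔄) v : Fin 1 → 𝔄) = fun _ => v from funext fun i => by
      rw [Fin.fin_one_eq_zero i]; exact Fin.snoc_last (α := fun _ : Fin 1 => 𝔄) _ _,
    FormalMultilinearSeries.ofScalars_apply_eq]
  simp [logSeriesCoeff]

/-- `ρ(g⁻¹) = ρ(g)⁻¹` as matrices. [folklore] -/
theorem map_inv_eq_nonsing_inv (g : G) : ρ g⁻¹ = (ρ g)⁻¹ :=
  (Matrix.inv_eq_left_inv (by rw [← map_mul, inv_mul_cancel, map_one])).symm

/-- Along a curve `g` in `G` through `1` whose image `ρ ∘ g` has derivative `g'` at `0`, the inverse has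
derivative `-g'`. [folklore] -/
theorem hasDerivAt_rho_inv {g : ℝ → G} {g' : Matrix (Fin N) (Fin N) ℂ} (hg0 : g 0 = 1)
    (hg : HasDerivAt (fun t => ρ (g t)) g' 0) : HasDerivAt (fun t => ρ (g t)⁻¹) (-g') 0 := by
  have hinv : (fun t => ρ (g t)⁻¹) = Ring.inverse ∘ fun t => ρ (g t) := funext fun t => by
    rw [Function.comp_apply, map_inv_eq_nonsing_inv, Matrix.nonsing_inv_eq_ringInverse]
  have h1 := hasFDerivAt_ringInverse (𝕜 := ℝ) (1 : (Matrix (Fin N) (Fin N) ℂ)ˣ)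
  rw [inv_one, Units.val_one, ← show ρ (g 0) = 1 by rw [hg0, map_one]] at h1
  rw [hinv]
  refine (h1.comp_hasDerivAt (0 : ℝ) hg).congr_deriv ?_
  simp [hg0]

/-- **Linearisation of the mean**: along curves `S`, `Tᵢ` in `G` through `1` (`ρ ∘ S`, `ρ ∘ Tᵢ` differentiable
at `0` with derivatives `s`, `τᵢ`), `t ↦ balabanMatrixMean ρ (S t) (T · t)` has derivative the ARITHMETIC
MEAN `(#ι)⁻¹ ∑ᵢ τᵢ` — the reference drops out at first order; this is condition (14) ("`(1/i) log Ū` is well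
approximated by the linear averaging operation"). [cite: Balaban1985Averaging, Intro (14)–(15)] -/
theorem hasDerivAt_balabanMatrixMean [Nonempty ι] {S : ℝ → G} {T : ι → ℝ → G}
    {s : Matrix (Fin N) (Fin N) ℂ} {τ : ι → Matrix (Fin N) (Fin N) ℂ} (hS0 : S 0 = 1) (hT0 : ∀ i, T i 0 = 1)
    (hS : HasDerivAt (fun t => ρ (S t)) s 0) (hT : ∀ i, HasDerivAt (fun t => ρ (T i t)) (τ i) 0) :
    HasDerivAt (fun t => balabanMatrixMean ρ (S t) (fun i => T i t))
      ((Fintype.card ι : ℂ)⁻¹ • ∑ i, τ i) 0 := by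
  have hW : ∀ i, HasDerivAt (fun t => ρ (T i t * (S t)⁻¹) - 1) (τ i - s) 0 := fun i => by
    have h := ((hT i).mul (hasDerivAt_rho_inv ρ hS0 hS)).sub_const 1
    rw [hS0, hT0 i, inv_one, map_one, mul_one, one_mul, ← sub_eq_add_neg] at h
    have he : (fun t => ρ (T i t * (S t)⁻¹) - 1) =
        fun t => ((fun t => ρ (T i t)) * fun t => ρ (S t)⁻¹) t - 1 := by
      funext t; simp only [Pi.mul_apply, map_mul]
    rw [he]
    exact h
  have hval : ∀ i, ρ (T i 0 * (S 0)⁻¹) - 1 = 0 := fun i => by simp [hS0, hT0]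
  have hlog : ∀ i, HasDerivAt (fun t => logOnePlus (ρ (T i t * (S t)⁻¹) - 1)) (τ i - s) 0 := fun i => by
    have hl := (hasFDerivAt_logOnePlus_zero (𝔄 := Matrix (Fin N) (Fin N) ℂ)).restrictScalars ℝ
    rw [← hval i] at hl
    simpa [Function.comp_def] using hl.comp_hasDerivAt (0 : ℝ) (hW i)
  have hsum : HasDerivAt (fun t => (Fintype.card ι : ℂ)⁻¹ • ∑ i, logOnePlus (ρ (T i t * (S t)⁻¹) - 1))
      ((Fintype.card ι : ℂ)⁻¹ • ∑ i, (τ i - s)) 0 :=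
    (HasDerivAt.fun_sum fun i _ => hlog i).fun_const_smul _
  have hval' : (Fintype.card ι : ℂ)⁻¹ • ∑ i, logOnePlus (ρ (T i 0 * (S 0)⁻¹) - 1) = 0 := by
    simp only [hval, logOnePlus_zero, Finset.sum_const_zero, smul_zero]
  have hexp : HasDerivAt
      (fun t => NormedSpace.exp ((Fintype.card ι : ℂ)⁻¹ • ∑ i, logOnePlus (ρ (T i t * (S t)⁻¹) - 1)))
      ((Fintype.card ι : ℂ)⁻¹ • ∑ i, (τ i - s)) 0 := by
    have he := hasFDerivAt_exp_zero (𝕂 := ℝ) (𝔸 := Matrix (Fin N) (Fin N) ℂ)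
    rw [← hval'] at he
    simpa [Function.comp_def] using he.comp_hasDerivAt (0 : ℝ) hsum
  have h := hexp.mul hS
  have hc : (Fintype.card ι : ℂ) ≠ 0 := Nat.cast_ne_zero.2 Fintype.card_ne_zero
  have hder : ((Fintype.card ι : ℂ)⁻¹ • ∑ i, (τ i - s)) * ρ (S 0) +
      NormedSpace.exp ((Fintype.card ι : ℂ)⁻¹ • ∑ i, logOnePlus (ρ (T i 0 * (S 0)⁻¹) - 1)) * s =
        (Fintype.card ι : ℂ)⁻¹ • ∑ i, τ i := by
    rw [hval', NormedSpace.exp_zero, hS0, map_one, mul_one, one_mul, Finset.sum_sub_distrib,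
      Finset.sum_const, Finset.card_univ, ← Nat.cast_smul_eq_nsmul ℂ, smul_sub, smul_smul,
      inv_mul_cancel₀ hc, one_smul, sub_add_cancel]
  rw [hder] at h
  exact h

end Mean

/-! ### The block average -/

section BlockAverage

variable {d : ℕ} {G : Type*} [Group G] {N : ℕ} (ρ : G →* Matrix (Fin N) (Fin N) ℂ) (M L' : ℕ)
  [NeZero M] [NeZero L']

/-- The block `B(y) = {x | ⌊x/M⌋ = y}` of the coarse site `y`, as a (finite, nonempty) type: the index set
of the averaged family. [cite: Balaban1985Averaging, Intro (2)] -/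
abbrev TorusBlock (y : TorusSite d L') : Type := {x : TorusSite d (M * L') // torusBlockOf M L' x = y}

/-- The corner `My` is a member of `B(y)`. [folklore] -/
def TorusBlock.corner (y : TorusSite d L') : TorusBlock M L' y :=
  ⟨torusBlockCorner M L' y, torusBlockOf_torusBlockCorner y⟩

/-- Blocks are nonempty. [folklore] -/
instance TorusBlock.instNonempty (y : TorusSite d L') : Nonempty (TorusBlock M L' y) :=
  ⟨TorusBlock.corner M L' y⟩

/-- `B(y) ≃ {0, …, M-1}^d` by the offsets `x ↦ x mod M` (inverse `w ↦ M y + w`). [folklore] -/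
def torusBlockEquiv (y : TorusSite d L') : TorusBlock M L' y ≃ (Fin d → Fin M) where
  toFun x := fun i => ⟨torusBlockOffset M L' x.1 i, Nat.mod_lt _ (Nat.pos_of_ne_zero (NeZero.ne M))⟩
  invFun w := ⟨torusBlockCorner M L' y + fun i => ((w i : ℕ) : ZMod (M * L')),
    torusBlockOf_corner_add M L' y fun i => (w i).isLt⟩
  left_inv x := by
    apply Subtype.ext
    have h := torusBlockCorner_torusBlockOf_add_offset (M := M) (L' := L') x.1
    rw [x.2] at h
    exact h
  right_inv w := by
    funext i
    exact Fin.ext (torusBlockOffset_corner_add M L' y (fun i => (w i).isLt) i)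

/-- **A block has `M^d` sites**: the weight of Bałaban's average is `L^{-d}` (here `M^{-d}`).
[cite: Balaban1985Averaging, Intro (2) and (15)] -/
theorem card_torusBlock (y : TorusSite d L') : Fintype.card (TorusBlock M L' y) = M ^ d := by
  rw [Fintype.card_congr (torusBlockEquiv M L' y), Fintype.card_fun, Fintype.card_fin, Fintype.card_fin]

/-- **Bałaban's block average in the representation** (formula (42) on the torus, tree geometry): the
coarse bond `c = (y, μ)` carries `exp( (#B(y))⁻¹ ∑_{x ∈ B(y)} log ρ(U(Γ_{c,x}) U(c)⁻¹) ) · ρ(U(c))`.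
[cite: Balaban1985Averaging, Intro (15) and Sect. B (42)] -/
def balabanMatrixAverage (U : GaugeConfig d (M * L') G) (e : QuantumFieldTheory.Edge d L') :
    Matrix (Fin N) (Fin N) ℂ :=
  balabanMatrixMean ρ (straightTransporter M L' U e)
    fun x : TorusBlock M L' e.1 => dressedTransporter M L' U e.1 e.2 x.1

/-- **Bałaban's non-linear gauge-covariant block average** `U ↦ Ū` from gauge fields on the fine torus
`(ℤ/ML'ℤ)^d` to gauge fields on the coarse torus `(ℤ/L'ℤ)^d`: the coarse bond `(y, μ)` carries the
`G`-valued exp/log mean of the `M^d` dressed transporters `U(Γ_{c,x})`, `x ∈ B(y)`, relative to the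
straight transporter `U(c)` — formula (42) pulled back to `G` on Bałaban's branch, `U(c)` off it (module
docstring, TOTALITY). Properties: `measurable_balabanBlockAverage`, `balabanBlockAverage_gaugeTransform`,
`dependsOn_balabanBlockAverage`, `hasDerivAt_balabanMatrixAverage`.
[cite: Balaban1985Averaging, Intro (10)–(15) and Sect. B (42)] [cite: Balaban1988Convergent, p. 243 (0.1)] -/
def balabanBlockAverage (U : GaugeConfig d (M * L') G) : GaugeConfig d L' G := fun e =>
  balabanGroupMean ρ (straightTransporter M L' U e)
    fun x : TorusBlock M L' e.1 => dressedTransporter M L' U e.1 e.2 x.1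

/-- Unfolding `balabanBlockAverage` at a coarse bond. [folklore] -/
theorem balabanBlockAverage_apply (U : GaugeConfig d (M * L') G) (e : QuantumFieldTheory.Edge d L') :
    balabanBlockAverage ρ M L' U e = balabanGroupMean ρ (straightTransporter M L' U e)
      fun x : TorusBlock M L' e.1 => dressedTransporter M L' U e.1 e.2 x.1 := rfl

/-- On Bałaban's branch the coarse link represents formula (42):
`ρ(Ū(c)) = exp((#B)⁻¹ ∑ log ρ(U(Γ_{c,x})U(c)⁻¹)) ρ(U(c))`. [cite: Balaban1985Averaging, Sect. B (42)] -/
theorem rho_balabanBlockAverage {U : GaugeConfig d (M * L') G} {e : QuantumFieldTheory.Edge d L'}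
    (h : IsSmallFamily ρ (straightTransporter M L' U e)
        (fun x : TorusBlock M L' e.1 => dressedTransporter M L' U e.1 e.2 x.1) ∧
      balabanMatrixAverage ρ M L' U e ∈ Set.range ρ) :
    ρ (balabanBlockAverage ρ M L' U e) = balabanMatrixAverage ρ M L' U e :=
  rho_balabanGroupMean ρ h

/-- Off Bałaban's branch the coarse link is the straight transporter (decimation). [folklore] -/
theorem balabanBlockAverage_of_not {U : GaugeConfig d (M * L') G} {e : QuantumFieldTheory.Edge d L'}
    (h : ¬ (IsSmallFamily ρ (straightTransporter M L' U e)
        (fun x : TorusBlock M L' e.1 => dressedTransporter M L' U e.1 e.2 x.1) ∧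
      balabanMatrixAverage ρ M L' U e ∈ Set.range ρ)) :
    balabanBlockAverage ρ M L' U e = straightTransporter M L' U e :=
  balabanGroupMean_of_not ρ h

/-- The block average of the trivial configuration is trivial (faithful `ρ`). [folklore] -/
theorem balabanBlockAverage_one (hinj : Function.Injective ρ) :
    balabanBlockAverage ρ M L' (1 : GaugeConfig d (M * L') G) = 1 := by
  funext e
  simp only [balabanBlockAverage_apply, straightTransporter_one, dressedTransporter_one, Pi.one_apply]
  exact balabanGroupMean_one ρ hinj

/-- **(ii) Gauge covariance / admissibility** (Bałaban's condition (11)): for unitary faithful `ρ`, a fine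
gauge transformation `g` acts on the block field as the coarse gauge transformation `g ∘ (y ↦ My)`:
`Ū(U^g) = (Ū U)^{g ∘ torusBlockCorner}` — the field `blockAvg_gaugeTransform` of
`BalabanBlockSpecification` and `link_gaugeTransform` of `GaugeCovariantBlockMap`.
[cite: Balaban1985Averaging, Intro (11) and Sect. B, after (43)] -/
theorem balabanBlockAverage_gaugeTransform (hρu : ∀ g, ρ g ∈ Matrix.unitaryGroup (Fin N) ℂ)
    (hinj : Function.Injective ρ) (g : TorusSite d (M * L') → G) (U : GaugeConfig d (M * L') G) :
    balabanBlockAverage ρ M L' (gaugeTransform g U) =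
      gaugeTransform (g ∘ torusBlockCorner M L') (balabanBlockAverage ρ M L' U) := by
  funext e
  have hT : (fun x : TorusBlock M L' e.1 => dressedTransporter M L' (gaugeTransform g U) e.1 e.2 x.1) =
      fun x => g (torusBlockCorner M L' e.1) * dressedTransporter M L' U e.1 e.2 x.1 *
        (g (torusBlockCorner M L' (e.1.shift e.2)))⁻¹ :=
    funext fun x => dressedTransporter_gaugeTransform M L' g U e.2 x.2
  rw [balabanBlockAverage_apply, straightTransporter_gaugeTransform, hT, balabanGroupMean_conj ρ hρu hinj]
  rfl

/-- **(i) Measurability** of `U ↦ Ū` (product Borel structures; faithful continuous `ρ` of a compact `G`) —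
the field `measurable_blockAvg` of `BalabanBlockSpecification`. [folklore] -/
theorem measurable_balabanBlockAverage [TopologicalSpace G] [IsTopologicalGroup G] [CompactSpace G]
    [MeasurableSpace G] [BorelSpace G] (hρc : Continuous ρ) (hinj : Function.Injective ρ) :
    Measurable (balabanBlockAverage (d := d) ρ M L') := by
  haveI : SecondCountableTopology G :=
    (hρc.isClosedEmbedding hinj).isEmbedding.secondCountableTopology
  refine measurable_pi_lambda _ fun e => ?_
  have hm : Measurable fun p : G × (TorusBlock M L' e.1 → G) => balabanGroupMean ρ p.1 p.2 :=
    measurable_balabanGroupMean ρ hρc hinj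
  have hS : Measurable fun U : GaugeConfig d (M * L') G => straightTransporter M L' U e :=
    (continuous_straightTransporter M L' e).measurable
  have hT : Measurable fun U : GaugeConfig d (M * L') G =>
      fun x : TorusBlock M L' e.1 => dressedTransporter M L' U e.1 e.2 x.1 :=
    measurable_pi_lambda _ fun x => (continuous_dressedTransporter M L' e.1 e.2 x.1).measurable
  have hf : Measurable fun U : GaugeConfig d (M * L') G =>
      (straightTransporter M L' U e, fun x : TorusBlock M L' e.1 => dressedTransporter M L' U e.1 e.2 x.1) :=
    hS.prodMk hT
  have h := hm.comp hf
  exact (show (fun U : GaugeConfig d (M * L') G => balabanBlockAverage ρ M L' U e) =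
    ((fun p : G × (TorusBlock M L' e.1 → G) => balabanGroupMean ρ p.1 p.2) ∘
      fun U : GaugeConfig d (M * L') G =>
        (straightTransporter M L' U e, fun x : TorusBlock M L' e.1 => dressedTransporter M L' U e.1 e.2 x.1))
    from rfl) ▸ h

/-- **(iii) Locality** ("`Ū_c`, depends only on the bond variables `U_b` for `b ⊂ B(c₋) ∪ B(c₊)`", p. 24):
the coarse link `(y, μ)` is a function of the fine links based in `B(y) ∪ B(y + e_μ)` alone.
[cite: Balaban1985Averaging, Sect. B, after (43)] -/
theorem dependsOn_balabanBlockAverage (e : QuantumFieldTheory.Edge d L') :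
    DependsOn (fun U : GaugeConfig d (M * L') G => balabanBlockAverage ρ M L' U e)
      {e' | torusBlockOf M L' e'.1 = e.1 ∨ torusBlockOf M L' e'.1 = e.1.shift e.2} := by
  intro U V h
  simp only [balabanBlockAverage_apply]
  rw [straightTransporter_congr M L' e fun e' he' => h e' he']
  congr 1
  funext x
  exact dressedTransporter_congr M L' e.2 x.2 fun e' he' => h e' he'

end BlockAverage

/-! ### (iv) Linearisation at `U ≡ 1`: the covariant linear block average `Q` -/

section Linearisation

variable {d : ℕ} {G : Type*} [Group G] {N : ℕ} (ρ : G →* Matrix (Fin N) (Fin N) ℂ)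

/-- The sum `A(Γ) = ∑_{b ∈ Γ} A(b)` of an edge function along the (positively oriented) path from `c` with
steps `is` — the linearisation of the transporter `U(Γ)` at `U ≡ 1`.
[cite: Balaban1984Propagators, §1 (1.8)] -/
def pathSum {L : ℕ} {V : Type*} [AddMonoid V] (A : QuantumFieldTheory.Edge d L → V)
    (c : QuantumFieldTheory.Site d L) (is : List (Fin d)) : V :=
  ((pathEdges c is).map A).sum

/-- `A(∅) = 0`. [folklore] -/
@[simp] theorem pathSum_nil {L : ℕ} {V : Type*} [AddMonoid V] (A : QuantumFieldTheory.Edge d L → V)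
    (c : QuantumFieldTheory.Site d L) : pathSum A c [] = 0 := rfl

/-- `A(Γ) = A(c, i) + A(Γ')`. [folklore] -/
theorem pathSum_cons {L : ℕ} {V : Type*} [AddMonoid V] (A : QuantumFieldTheory.Edge d L → V)
    (c : QuantumFieldTheory.Site d L) (i : Fin d) (is : List (Fin d)) :
    pathSum A c (i :: is) = A (c, i) + pathSum A (c.shift i) is := by
  simp [pathSum, pathEdges]

/-- Along a curve of configurations `U_t` with `U_0 = 1` and link derivatives `A(b)`, the transporter along a
path has derivative the sum of `A` along the path (Leibniz rule at `U = 1`). [folklore] -/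
theorem hasDerivAt_rho_transport {L : ℕ} {U : ℝ → GaugeConfig d L G}
    {A : QuantumFieldTheory.Edge d L → Matrix (Fin N) (Fin N) ℂ} (hU0 : U 0 = 1)
    (hU : ∀ b, HasDerivAt (fun t => ρ (U t b)) (A b) 0) (c : QuantumFieldTheory.Site d L)
    (is : List (Fin d)) :
    HasDerivAt (fun t => ρ (transport (U t) c is)) (pathSum A c is) 0 := by
  induction is generalizing c with
  | nil => simp only [transport_nil, map_one, pathSum_nil]; exact hasDerivAt_const _ _
  | cons i is ih =>
    simp only [transport_cons, map_mul, pathSum_cons]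
    have h := (hU (c, i)).mul (ih (c.shift i))
    simp only [hU0, transport_one_config, map_one, mul_one, Pi.one_apply, one_mul] at h
    exact h

variable (M L' : ℕ) [NeZero M] [NeZero L']

/-- **The covariant linear block average `Q`** of a Lie-algebra-valued edge field `A` (Bałaban /
Gawędzki–Kupiainen): `(QA)(y, μ) = (#B(y))⁻¹ ∑_{x ∈ B(y)} A(Γ_{c,x})` with
`A(Γ_{c,x}) = A(Γ_{My,x}) + A(x → x + Me_μ) - A(Γ_{M(y+e_μ), x+Me_μ})` — the linearisation (14) of `Ū`
(Bałaban's `Q` of [Balaban1984Propagators, (1.8)] up to his lattice-spacing normalisation of `A`).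
[cite: Balaban1985Averaging, Intro (14)] [cite: Balaban1984Propagators, §1 (1.8)] -/
def linearBlockAverage {V : Type*} [AddCommGroup V] [Module ℂ V] (A : QuantumFieldTheory.Edge d (M * L') → V)
    (e : QuantumFieldTheory.Edge d L') : V :=
  (Fintype.card (TorusBlock M L' e.1) : ℂ)⁻¹ • ∑ x : TorusBlock M L' e.1,
    (pathSum A (torusBlockCorner M L' e.1) (torusBlockPath M L' x.1) + pathSum A x.1 (List.replicate M e.2) -
      pathSum A (torusBlockCorner M L' (e.1.shift e.2)) (torusBlockPath M L' x.1))

/-- **(iv) Linearisation of Bałaban's average at `U ≡ 1` is `Q`**: for every curve of configurations `U_t`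
with `U_0 = 1` whose links have derivatives `d/dt ρ(U_t(b))|₀ = A(b)`,
`d/dt balabanMatrixAverage ρ M L' U_t (y, μ)|₀ = linearBlockAverage M L' A (y, μ)` — condition (14): "taking
`U = e^{iA}` with `A` small and expanding the logarithm … we get the expression (14) as a linear term".
[cite: Balaban1985Averaging, Intro (14)–(15)] -/
theorem hasDerivAt_balabanMatrixAverage {U : ℝ → GaugeConfig d (M * L') G}
    {A : QuantumFieldTheory.Edge d (M * L') → Matrix (Fin N) (Fin N) ℂ} (hU0 : U 0 = 1)
    (hU : ∀ b, HasDerivAt (fun t => ρ (U t b)) (A b) 0) (e : QuantumFieldTheory.Edge d L') :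
    HasDerivAt (fun t => balabanMatrixAverage ρ M L' (U t) e) (linearBlockAverage M L' A e) 0 := by
  have hS : HasDerivAt (fun t => ρ (straightTransporter M L' (U t) e))
      (pathSum A (torusBlockCorner M L' e.1) (List.replicate M e.2)) 0 :=
    hasDerivAt_rho_transport ρ hU0 hU _ _
  have hT : ∀ x : TorusBlock M L' e.1, HasDerivAt (fun t => ρ (dressedTransporter M L' (U t) e.1 e.2 x.1))
      (pathSum A (torusBlockCorner M L' e.1) (torusBlockPath M L' x.1) +
        pathSum A x.1 (List.replicate M e.2) -
        pathSum A (torusBlockCorner M L' (e.1.shift e.2)) (torusBlockPath M L' x.1)) 0 := fun x => by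
    have h1 := hasDerivAt_rho_transport ρ hU0 hU (torusBlockCorner M L' e.1) (torusBlockPath M L' x.1)
    have h2 := hasDerivAt_rho_transport ρ hU0 hU x.1 (List.replicate M e.2)
    have h3 := hasDerivAt_rho_inv ρ
      (g := fun t => transport (U t) (torusBlockCorner M L' (e.1.shift e.2)) (torusBlockPath M L' x.1))
      (by simp [hU0, transport_one_config])
      (hasDerivAt_rho_transport ρ hU0 hU (torusBlockCorner M L' (e.1.shift e.2)) (torusBlockPath M L' x.1))
    have h := (h1.mul h2).mul h3
    refine (h.congr_of_eventuallyEq (Eventually.of_forall fun t => ?_)).congr_deriv ?_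
    · simp only [Pi.mul_apply, dressedTransporter, map_mul]
    · simp only [hU0, transport_one_config, map_one, mul_one, one_mul, inv_one, Pi.mul_apply, mul_neg,
        sub_eq_add_neg]
  exact hasDerivAt_balabanMatrixMean ρ (S := fun t => straightTransporter M L' (U t) e)
    (T := fun (x : TorusBlock M L' e.1) t => dressedTransporter M L' (U t) e.1 e.2 x.1)
    (by simp [hU0]) (fun x => by simp [hU0]) hS hT

/-- **(iv) for the `G`-valued average**: along curves that stay on Bałaban's branch near `t = 0`
(automatic for a compact Lie group `ρ(G)`, since the dressed family tends to the reference as `t → 0`; a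
hypothesis for abstract `G`), `d/dt ρ(Ū(U_t)(y, μ))|₀ = (QA)(y, μ)`.
[cite: Balaban1985Averaging, Intro (14)–(15)] -/
theorem hasDerivAt_rho_balabanBlockAverage {U : ℝ → GaugeConfig d (M * L') G}
    {A : QuantumFieldTheory.Edge d (M * L') → Matrix (Fin N) (Fin N) ℂ} (hU0 : U 0 = 1)
    (hU : ∀ b, HasDerivAt (fun t => ρ (U t b)) (A b) 0) (e : QuantumFieldTheory.Edge d L')
    (hbranch : ∀ᶠ t in 𝓝 (0 : ℝ), IsSmallFamily ρ (straightTransporter M L' (U t) e)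
        (fun x : TorusBlock M L' e.1 => dressedTransporter M L' (U t) e.1 e.2 x.1) ∧
      balabanMatrixAverage ρ M L' (U t) e ∈ Set.range ρ) :
    HasDerivAt (fun t => ρ (balabanBlockAverage ρ M L' (U t) e)) (linearBlockAverage M L' A e) 0 :=
  (hasDerivAt_balabanMatrixAverage ρ M L' hU0 hU e).congr_of_eventuallyEq
    (hbranch.mono fun _ ht => rho_balabanBlockAverage ρ M L' ht)

end Linearisation

/-! ### Corollaries for a lattice representation `r : LatticeRep G` -/

section LatticeRepCorollaries

variable {d : ℕ} {G : Type*} [Group G] [TopologicalSpace G] (r : LatticeRep G) (M L' : ℕ)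
  [NeZero M] [NeZero L']

/-- (i) for `LatticeRep`: Bałaban's block average in a faithful continuous unitary representation of a
compact group is measurable. [folklore] -/
theorem measurable_balabanBlockAverage_latticeRep [IsTopologicalGroup G] [CompactSpace G]
    [MeasurableSpace G] [BorelSpace G] :
    Measurable (balabanBlockAverage (d := d) r.ρ M L') :=
  measurable_balabanBlockAverage r.ρ M L' r.continuous r.injective

/-- (ii) for `LatticeRep`: `Ū(U^g) = (Ū U)^{g ∘ torusBlockCorner}`.
[cite: Balaban1985Averaging, Intro (11)] -/
theorem balabanBlockAverage_gaugeTransform_latticeRep (g : TorusSite d (M * L') → G)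
    (U : GaugeConfig d (M * L') G) :
    balabanBlockAverage r.ρ M L' (gaugeTransform g U) =
      gaugeTransform (g ∘ torusBlockCorner M L') (balabanBlockAverage r.ρ M L' U) :=
  balabanBlockAverage_gaugeTransform r.ρ M L' r.mem_unitary r.injective g U

/-- The block average of the trivial field is trivial. [folklore] -/
theorem balabanBlockAverage_one_latticeRep :
    balabanBlockAverage r.ρ M L' (1 : GaugeConfig d (M * L') G) = 1 :=
  balabanBlockAverage_one r.ρ M L' r.injective

end LatticeRepCorollaries

end Literature.MathematicalPhysics.QuantumLattice
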